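import Summits.Ventures.QEC.Census.CertTwoBlockShiftWindow
import Summits.Ventures.QEC.Census.CertTwoBlockShiftSound
import HarnessLib

/-!
# The two-block shift lane, v2 (cyclic window) — soundness (qec-type-01 gen 5; companion of `Census/CertTwoBlockShiftWindow.lean`)

`exists_shift_window`: in `ZMod m`, a nonempty set `U` of `≤ j` residues with `j·(m − W − 1) < m` has a member `r` with `(x − r).val ≤ W`
for every `x ∈ U` (double count over all `m` rotations, then shift to the minimum). `half_coreW` / `half_soundW` / `shift_lower_soundW`: the
v1 argument (`Census/CertTwoBlockShiftSound.lean`) with the light rows restricted to the window — the support point moved to `p₀` is the one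
named by `exists_shift_window` (digits of the light support), and the word's digit-translation check (`tabWinOK`) puts every other light support
point inside the window. Conclusion = the flat `hlow` hypothesis of qec-type-10's `DistCert.isCode_of_onesided_lower`; wrappers
`DistCert.lowZ_of_shiftW` / `dZ_code_of_shiftW`. HONEST FRAMING: no certificate is read, no distance asserted. Tier KERNEL, axioms standard,
no `native_decide`. [folklore]
-/

set_option autoImplicit false

namespace Summit.Ventures.QEC.Census

open Matrix Literature.InformationTheory.QuantumCodes List

/-! ## The counting lemma -/

/-- In `ZMod m` at most `m − W − 1` residues have value `> W`. -/
theorem card_filter_val_gt {m : ℕ} [NeZero m] (W : ℕ) :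
    (Finset.univ.filter fun y : ZMod m => W < y.val).card ≤ m - W - 1 := by
  have hinj : Set.InjOn (fun y : ZMod m => y.val) ↑(Finset.univ.filter fun y : ZMod m => W < y.val) :=
    fun a _ b _ h => ZMod.val_injective m h
  have hmaps : ∀ y ∈ (Finset.univ.filter fun y : ZMod m => W < y.val), (fun y : ZMod m => y.val) y ∈ Finset.Ioo W m := by
    intro y hy
    rw [Finset.mem_filter] at hy
    rw [Finset.mem_Ioo]
    exact ⟨hy.2, ZMod.val_lt y⟩
  have := Finset.card_le_card_of_injOn _ hmaps hinj
  rwa [Nat.card_Ioo] at this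

/-- Rotating by `x − ·` preserves the count of residues of value `> W`. -/
theorem card_filter_sub_val_gt {m : ℕ} [NeZero m] (W : ℕ) (x : ZMod m) :
    (Finset.univ.filter fun r : ZMod m => W < (x - r).val).card =
      (Finset.univ.filter fun y : ZMod m => W < y.val).card := by
  refine Finset.card_equiv (Equiv.subLeft x) fun r => ?_
  simp [Equiv.subLeft]

/-- **The window lemma**: a nonempty `U ⊆ ZMod m` with `|U| ≤ j` and `j·(m − W − 1) < m` has a member `r` with `(x − r).val ≤ W` for all
`x ∈ U`. -/
theorem exists_shift_window {m : ℕ} [NeZero m] (U : Finset (ZMod m)) (hU : U.Nonempty) {j W : ℕ} (hj : U.card ≤ j)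
    (hW : j * (m - W - 1) < m) : ∃ r ∈ U, ∀ x ∈ U, (x - r).val ≤ W := by
  -- Step 1: some rotation `r₀` (not necessarily in `U`) works
  have h1 : ∃ r₀ : ZMod m, ∀ x ∈ U, (x - r₀).val ≤ W := by
    by_contra hne
    have hall : ∀ r : ZMod m, 1 ≤ (U.filter fun x => W < (x - r).val).card := by
      intro r
      rw [Nat.one_le_iff_ne_zero, Ne, Finset.card_eq_zero, Finset.filter_eq_empty_iff]
      intro h0
      exact hne ⟨r, fun x hx => not_lt.1 (h0 hx)⟩
    have hsum : m ≤ ∑ r : ZMod m, (U.filter fun x => W < (x - r).val).card := by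
      calc m = ∑ _r : ZMod m, 1 := by simp [ZMod.card]
        _ ≤ _ := Finset.sum_le_sum fun r _ => hall r
    have hswap : ∑ r : ZMod m, (U.filter fun x => W < (x - r).val).card =
        ∑ x ∈ U, (Finset.univ.filter fun r : ZMod m => W < (x - r).val).card := by
      simp only [Finset.card_filter]
      exact Finset.sum_comm
    have hle : ∑ x ∈ U, (Finset.univ.filter fun r : ZMod m => W < (x - r).val).card ≤ U.card * (m - W - 1) := by
      calc _ ≤ ∑ _x ∈ U, (m - W - 1) := Finset.sum_le_sum fun x _ => by
              rw [card_filter_sub_val_gt]; exact card_filter_val_gt W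
        _ = U.card * (m - W - 1) := by rw [Finset.sum_const, smul_eq_mul]
    have : m ≤ j * (m - W - 1) := le_trans (hswap ▸ hsum) (le_trans hle (Nat.mul_le_mul_right _ hj))
    omega
  -- Step 2: shift to the member of least relative value
  obtain ⟨r₀, hr₀⟩ := h1
  obtain ⟨r, hr, hmin⟩ := Finset.exists_min_image U (fun x => (x - r₀).val) hU
  refine ⟨r, hr, fun x hx => ?_⟩
  have hle := hmin x hx
  have : x - r = (x - r₀) - (r - r₀) := by ring
  rw [this, ZMod.val_sub hle]
  exact le_trans (Nat.sub_le _ _) (hr₀ x hx)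

/-- Bridge `ℕ` ↔ `ZMod`: for `b < m`, `(a + (m − b)) % m` is the value of `a − b` in `ZMod m`. -/
theorem mod_eq_val_sub {m : ℕ} [NeZero m] (a b : ℕ) (hb : b < m) :
    (a + (m - b)) % m = ((a : ZMod m) - (b : ZMod m)).val := by
  have : ((a + (m - b) : ℕ) : ZMod m) = (a : ZMod m) - (b : ZMod m) := by
    rw [Nat.cast_add, Nat.cast_sub hb.le, ZMod.natCast_self, zero_sub, sub_eq_add_neg]
  rw [← this, ZMod.val_natCast]

section Sound

variable {n : ℕ} {Hsyn Hstab : List ℕ}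

/-- **The windowed core step** (no transport): as `half_core`, for a vector whose light support lies inside the window. -/
theorem half_coreW {found : List (ℕ × List ℕ)} (hfound : ∀ e ∈ found, xorRows Hstab e.2 = e.1) (h : ShiftHalf) (wn : ShiftWin)
    (hpiv : pivotsOK n h.ic.piv h.ic.red = true) (hcomb : combOK Hsyn h.ic.red h.ic.comb = true)
    (hp0free : h.ic.piv.elem h.p0 = false) (hp0n : h.p0 < n) (hp0L : h.inL h.p0 = true)
    {wmax t : ℕ}
    (htop : ∀ z ∈ h.zList n, TopReaches (bzLeaf wmax (found.map Prod.fst)) (h.lightRowsW wn n) (h.topRow z) (t - 1))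
    (v : Fin n → ZMod 2) (hv : rowMatrix n Hsyn *ᵥ v = 0) (hv' : v ∉ rowSpace (rowMatrix n Hstab))
    (hwt : hammingNorm v ≤ wmax) (hlight : countB h.inL (suppIdx n v) ≤ t) (hp0 : v ⟨h.p0, hp0n⟩ ≠ 0)
    (hwin : ∀ q ∈ suppIdx n v, h.inL q = true → h.winOK wn q = true) : False := by
  set sI := suppIdx n v with hsI
  set P : ℕ → Bool := fun q => h.inL q && !(h.ic.piv.elem q) && !(q == h.p0) with hP
  set PW : ℕ → Bool := fun q => h.inL q && !(h.ic.piv.elem q) && !(q == h.p0) && h.winOK wn q with hPW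
  set Q : ℕ → Bool := fun q => !(h.inL q) && !(h.ic.piv.elem q) with hQ
  set Scols := sI.filter P with hScols
  set Zcols := sI.filter Q with hZcols
  set z := xorList (Zcols.map (kerVec h.ic.piv h.ic.red)) with hz
  have hsub : sI.Sublist (List.range n) := suppIdx_sublist_range v
  have hnd : sI.Nodup := nodup_suppIdx n v
  have hdec := eq_ofBits_freeSupp (Hsyn := Hsyn) hpiv hcomb hv
  set light := (freeSupp n h.ic.piv v).filter h.inL with hlightDef
  have hfree : freeSupp n h.ic.piv v = sI.filter fun q => !(h.ic.piv.elem q) := rfl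
  have hp0mem : h.p0 ∈ light := by
    rw [hlightDef, List.mem_filter, hfree, List.mem_filter]
    exact ⟨⟨(mem_suppIdx_iff n v ⟨h.p0, hp0n⟩).2 hp0, by simp only [hp0free, Bool.not_false]⟩, hp0L⟩
  have hlightP : light.filter (fun q => !(q == h.p0)) = Scols := by
    rw [hlightDef, hfree, List.filter_filter, List.filter_filter, hScols]
    exact List.filter_congr fun x _ => by
      simp only [hP]; cases h.inL x <;> cases h.ic.piv.elem x <;> cases (x == h.p0) <;> rfl
  have hlight0 : light.filter (fun q => !!(q == h.p0)) = [h.p0] := by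
    have : light.filter (fun q => !!(q == h.p0)) = light.filter (fun q => q == h.p0) :=
      List.filter_congr fun x _ => by cases (x == h.p0) <;> rfl
    have hndl : light.Nodup := (hnd.filter _).filter _
    rw [this, List.filter_beq, List.count_eq_one_of_mem hndl hp0mem, List.replicate_one]
  have hheavy : (freeSupp n h.ic.piv v).filter (fun q => !(h.inL q)) = Zcols := by
    rw [hfree, List.filter_filter, hZcols]
  have hX : xorList ((freeSupp n h.ic.piv v).map (kerVec h.ic.piv h.ic.red)) =
      xorList (Scols.map (kerVec h.ic.piv h.ic.red)) ^^^ ((kerVec h.ic.piv h.ic.red) h.p0 ^^^ z) := by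
    rw [xorList_map_filter (kerVec h.ic.piv h.ic.red) h.inL, ← hlightDef, hheavy,
      xorList_map_filter (kerVec h.ic.piv h.ic.red) (fun q => !(q == h.p0)) light,
      hlightP, hlight0, List.map_singleton, xorList, xorList, Nat.xor_zero, Nat.xor_assoc]
  have hSlen : Scols.length ≤ t - 1 := by
    have h1 : light.length = Scols.length + 1 := by
      rw [List.length_eq_length_filter_add (fun q => !(q == h.p0)), hlightP, hlight0, List.length_singleton]
    have h2 : light.length ≤ countB h.inL sI := by
      rw [← length_filter_eq_countB, hlightDef, hfree, List.filter_filter]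
      have : (sI.filter fun a => h.inL a && !(h.ic.piv.elem a)) = (sI.filter h.inL).filter fun q => !(h.ic.piv.elem q) := by
        rw [List.filter_filter]
        exact List.filter_congr fun x _ => by cases h.inL x <;> cases h.ic.piv.elem x <;> rfl
      rw [this]
      exact (List.filter_sublist).length_le
    have h3 : 1 ≤ light.length := List.length_pos_of_mem hp0mem
    omega
  have hzmem : z ∈ h.zList n := by
    rw [hz, ShiftHalf.zList]
    exact xorList_mem_subXors ((hsub.filter Q).map (kerVec h.ic.piv h.ic.red))
  -- the window: on the support, `P` and `PW` agree
  have hSW : Scols = sI.filter PW := by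
    rw [hScols]
    refine List.filter_congr fun x hx => ?_
    simp only [hP, hPW]
    cases hLx : h.inL x
    · simp
    · rw [hwin x hx hLx]; simp
  have hSsub : (Scols.map (kerVec h.ic.piv h.ic.red)).Sublist (h.lightRowsW wn n) := by
    rw [ShiftHalf.lightRowsW, ShiftHalf.lightColsW, hSW]
    exact (hsub.filter PW).map (kerVec h.ic.piv h.ic.red)
  obtain ⟨S, hS, hSx, hSl, -, -⟩ := exists_rowPos_sublist (h.lightRowsW wn n) 0 (Scols.map (kerVec h.ic.piv h.ic.red)) hSsub
  have hleaf := htop z hzmem S hS (by rw [hSl, List.length_map]; exact hSlen)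
  have hu : (xorFst S ^^^ 2 ^ (h.lightRowsW wn n).length) ≠ 0 := by
    intro h0
    have hb := congrArg (fun x => Nat.testBit x (h.lightRowsW wn n).length) h0
    simp only [Nat.testBit_xor, Nat.testBit_two_pow_self, Nat.zero_testBit,
      Nat.testBit_lt_two_pow (xorFst_lt_of_sublist_rowPos _ hS)] at hb
    simp at hb
  have hc : xorSnd S ^^^ h.topRow z = xorList ((freeSupp n h.ic.piv v).map (kerVec h.ic.piv h.ic.red)) := by
    rw [hX, hSx, ShiftHalf.topRow]
  rw [bzLeaf, hc] at hleaf
  simp only [Bool.or_eq_true, beq_iff_eq] at hleaf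
  have hclt : xorList ((freeSupp n h.ic.piv v).map (kerVec h.ic.piv h.ic.red)) < 2 ^ n := by
    refine xorList_lt n _ fun x hx => ?_
    obtain ⟨j, hj, rfl⟩ := List.mem_map.1 hx
    exact kerVec_lt_two_pow hpiv (lt_of_mem_freeSupp v hj)
  rcases hleaf with (h0 | hwt') | hmem
  · exact hu h0
  · have := lt_popc_of_wtGt n wmax _ hclt hwt'
    rw [← hammingNorm_ofBits, ← hdec] at this
    omega
  · apply hv'
    rw [hdec]
    obtain ⟨e, he, hex⟩ : ∃ e ∈ found, e.1 = xorList ((freeSupp n h.ic.piv v).map (kerVec h.ic.piv h.ic.red)) := by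
      simpa [List.mem_map] using List.mem_of_elem_eq_true hmem
    rw [← hex, ← hfound e he]
    exact ofBits_xorRows_mem_rowSpace n Hstab e.2

/-- **Soundness of one windowed half**: no non-trivial logical of weight `≤ wmax` has `≤ t` support points in the light block. -/
theorem half_soundW (hcomm : rowMatrix n Hsyn * (rowMatrix n Hstab)ᵀ = 0) {found : List (ℕ × List ℕ)}
    (hfound : foundOK Hstab found = true)
    {gens : List AutGen} (hgens : autGensOK n Hsyn Hstab gens = true)
    (h : ShiftHalf) (wn : ShiftWin) {wmax t : ℕ} (hst : h.structOKW wn n Hsyn gens t = true)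
    (hzero : h.zeroCaseOK n wmax (found.map Prod.fst) = true)
    (htop : ∀ z ∈ h.zList n, TopReaches (bzLeaf wmax (found.map Prod.fst)) (h.lightRowsW wn n) (h.topRow z) (t - 1))
    (w : Fin n → ZMod 2) (hw : rowMatrix n Hsyn *ᵥ w = 0) (hw' : w ∉ rowSpace (rowMatrix n Hstab))
    (hwt : hammingNorm w ≤ wmax) (hlight : countB h.inL (suppIdx n w) ≤ t) : False := by
  simp only [foundOK, List.all_eq_true, beq_iff_eq] at hfound
  simp only [ShiftHalf.structOKW, ShiftHalf.structOK, infoSetStructOK, Bool.and_eq_true, decide_eq_true_eq, beq_iff_eq,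
    List.all_eq_true, List.mem_range, Bool.not_eq_true'] at hst
  obtain ⟨⟨⟨⟨⟨⟨⟨⟨-, ⟨hpiv, hcomb⟩⟩, ⟨⟨hp0L, hp0free⟩, hp0n⟩⟩, hwlen⟩, hwords⟩, htab⟩, hm⟩, hgap⟩, htabW⟩ := hst
  haveI : NeZero wn.m := ⟨by omega⟩
  by_cases hzeroL : countB h.inL (suppIdx n w) = 0
  · -- (a) no support in the light block: `w` is a coset word (as in v1)
    have hdec := eq_ofBits_freeSupp (Hsyn := Hsyn) hpiv hcomb hw
    have hsub : (suppIdx n w).Sublist (List.range n) := suppIdx_sublist_range w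
    have hnoL : ∀ x ∈ suppIdx n w, h.inL x = false := by
      intro x hx
      by_contra hxL
      rw [Bool.not_eq_false] at hxL
      have : 1 ≤ countB h.inL (suppIdx n w) := by
        rw [← length_filter_eq_countB]
        exact List.length_pos_of_mem (List.mem_filter.2 ⟨hx, hxL⟩)
      omega
    set Q : ℕ → Bool := fun q => !(h.inL q) && !(h.ic.piv.elem q) with hQ
    have hfreeQ : freeSupp n h.ic.piv w = (suppIdx n w).filter Q := by
      rw [freeSupp]
      exact List.filter_congr fun x hx => by rw [hQ]; simp [hnoL x hx]
    have hzmem : xorList ((freeSupp n h.ic.piv w).map (kerVec h.ic.piv h.ic.red)) ∈ h.zList n := by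
      rw [hfreeQ, ShiftHalf.zList]
      exact xorList_mem_subXors ((hsub.filter Q).map (kerVec h.ic.piv h.ic.red))
    simp only [ShiftHalf.zeroCaseOK, List.all_eq_true, Bool.or_eq_true, beq_iff_eq] at hzero
    have hclt : xorList ((freeSupp n h.ic.piv w).map (kerVec h.ic.piv h.ic.red)) < 2 ^ n := by
      refine xorList_lt n _ fun x hx => ?_
      obtain ⟨j, hj, rfl⟩ := List.mem_map.1 hx
      exact kerVec_lt_two_pow hpiv (lt_of_mem_freeSupp w hj)
    rcases hzero _ hzmem with (h0 | hwt') | hmem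
    · exact hw' (by rw [hdec, h0, ofBits_zero]; exact Submodule.zero_mem _)
    · have := lt_popc_of_wtGt n wmax _ hclt hwt'
      rw [← hammingNorm_ofBits, ← hdec] at this
      omega
    · apply hw'
      rw [hdec]
      obtain ⟨e, he, hex⟩ : ∃ e ∈ found, e.1 = xorList ((freeSupp n h.ic.piv w).map (kerVec h.ic.piv h.ic.red)) := by
        simpa [List.mem_map] using List.mem_of_elem_eq_true hmem
      rw [← hex, ← hfound e he]
      exact ofBits_xorRows_mem_rowSpace n Hstab e.2
  · -- (b) light support: choose the point named by the window lemma, transport it to `p₀`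
    set LS := (suppIdx n w).filter h.inL with hLS
    have hLSlen : LS.length = countB h.inL (suppIdx n w) := length_filter_eq_countB _ _
    set U : Finset (ZMod wn.m) := (LS.map fun q => ((h.digOf wn q : ℕ) : ZMod wn.m)).toFinset with hUdef
    have hUne : U.Nonempty := by
      have : LS ≠ [] := fun h0 => hzeroL (by rw [← hLSlen, h0, List.length_nil])
      obtain ⟨q, hq⟩ := List.exists_mem_of_ne_nil LS this
      exact ⟨_, List.mem_toFinset.2 (List.mem_map.2 ⟨q, hq, rfl⟩)⟩
    have hUcard : U.card ≤ t :=
      le_trans (List.toFinset_card_le _) (by rw [List.length_map, hLSlen]; exact hlight)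
    obtain ⟨r, hrU, hrW⟩ := exists_shift_window U hUne hUcard hgap
    obtain ⟨p, hpLS, hpr⟩ : ∃ p ∈ LS, ((h.digOf wn p : ℕ) : ZMod wn.m) = r := by
      have := List.mem_toFinset.1 hrU
      simpa [List.mem_map] using this
    obtain ⟨hp, hpL⟩ := List.mem_filter.1 hpLS
    have hpn : p < n := lt_of_mem_suppIdx n w hp
    have hpL' := hpL
    simp only [ShiftHalf.inL, Bool.and_eq_true, decide_eq_true_eq] at hpL'
    set i := p - h.lo with hi
    have hiw : i < h.hi - h.lo := by omega
    have hilen : i < h.words.length := by rw [hwlen]; exact hiw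
    set wd := h.words.getD i [] with hwdDef
    have hwdmem : wd ∈ h.words := by
      rw [hwdDef, List.getD_eq_getElem?_getD, List.getElem?_eq_getElem hilen, Option.getD_some]
      exact List.getElem_mem hilen
    have hwd : ∀ g ∈ wd, g < gens.length := lt_of_autWordsOK hwords hwdmem
    have hwd' : ∀ g ∈ wd, g < (autPerms gens).length := by rw [List.length_map]; exact hwd
    set σ := wordEquiv n (autPerms gens) wd with hσ
    obtain ⟨hz1, hz2, hz3⟩ := orbit_transport hcomm hgens hwd w hw hw'
    set v := w ∘ σ.symm with hvDef
    have hval : ∀ q : Fin n, permFun (wordPerm n (autPerms gens) wd) q = ((σ q : Fin n) : ℕ) :=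
      wordEquiv_val (permListOK_of_autGensOK hgens) wd hwd'
    have hlop : h.lo + i = p := by omega
    have htab' := htab i hiw
    have htabW' := htabW i hiw
    rw [← hwdDef, hlop] at htab' htabW'
    simp only [ShiftHalf.tabOK, Bool.and_eq_true, beq_iff_eq, List.all_eq_true, List.mem_range] at htab'
    simp only [ShiftHalf.tabWinOK, beq_iff_eq, List.all_eq_true, List.mem_range] at htabW'
    obtain ⟨htabp, htabL⟩ := htab'
    have hσp : σ ⟨p, hpn⟩ = ⟨h.p0, hp0n⟩ := Fin.ext (by rw [← hval ⟨p, hpn⟩]; exact htabp)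
    have hvp0 : v ⟨h.p0, hp0n⟩ ≠ 0 := by
      rw [hvDef, Function.comp_apply, ← hσp, Equiv.symm_apply_apply]
      exact (mem_suppIdx_iff n w ⟨p, hpn⟩).1 hp
    have hcount : countB h.inL (suppIdx n v) = countB h.inL (suppIdx n w) := by
      rw [hvDef, countB_suppIdx_comp_symm σ w h.inL (permFun (wordPerm n (autPerms gens) wd)) hval]
      exact countB_congr _ _ _ fun x hx => (htabL x (lt_of_mem_suppIdx n w hx)).symm
    -- every light support point of `v` is inside the window
    have hwin : ∀ q ∈ suppIdx n v, h.inL q = true → h.winOK wn q = true := by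
      intro q hq hqL
      have hqn : q < n := lt_of_mem_suppIdx n v hq
      -- `q = σ x` with `x ∈ supp w`, `x` light
      set x : Fin n := σ.symm ⟨q, hqn⟩ with hxDef
      have hwx : w x ≠ 0 := by
        have := (mem_suppIdx_iff n v ⟨q, hqn⟩).1 hq
        rwa [hvDef, Function.comp_apply] at this
      have hxq : permFun (wordPerm n (autPerms gens) wd) x = q := by
        rw [hval x, hxDef, Equiv.apply_symm_apply]
      have hxL : h.inL x = true := by rw [htabL x x.2, hxq]; exact hqL
      have hxL' := hxL
      simp only [ShiftHalf.inL, Bool.and_eq_true, decide_eq_true_eq] at hxL'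
      have hux : (x : ℕ) - h.lo < h.hi - h.lo := by omega
      have hdig := htabW' ((x : ℕ) - h.lo) hux
      rw [show h.lo + ((x : ℕ) - h.lo) = (x : ℕ) by omega, hxq] at hdig
      -- the window lemma for the digit of `x`
      have hxU : ((h.digOf wn x : ℕ) : ZMod wn.m) ∈ U :=
        List.mem_toFinset.2 (List.mem_map.2 ⟨x, List.mem_filter.2 ⟨(mem_suppIdx_iff n w x).2 hwx, hxL⟩, rfl⟩)
      have hle := hrW _ hxU
      rw [← hpr] at hle
      -- rewrite the goal as a `ZMod` value
      have hm0 : 0 < wn.m := by omega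
      rw [ShiftHalf.winOK, decide_eq_true_eq, mod_eq_val_sub _ _ (Nat.mod_lt _ hm0)]
      have hcast : ((h.digOf wn q % wn.m : ℕ) : ZMod wn.m) - ((h.digOf wn h.p0 % wn.m : ℕ) : ZMod wn.m) =
          ((h.digOf wn x : ℕ) : ZMod wn.m) - ((h.digOf wn p : ℕ) : ZMod wn.m) := by
        rw [hdig]
        simp only [ZMod.natCast_mod, Nat.cast_add, Nat.cast_sub (Nat.mod_lt _ hm0).le, ZMod.natCast_self]
        ring
      rw [hcast]
      exact hle
    exact half_coreW hfound h wn hpiv hcomb hp0free hp0n hp0L htop v hz1 hz2 (hz3 ▸ hwt) (hcount ▸ hlight) hvp0 hwin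

/-- **SOUNDNESS OF THE WINDOWED TWO-BLOCK SHIFT LANE (one side).** -/
theorem shift_lower_soundW (hcomm : rowMatrix n Hsyn * (rowMatrix n Hstab)ᵀ = 0) {found : List (ℕ × List ℕ)}
    (hfound : foundOK Hstab found = true) (s : ShiftSideW) {wmax : ℕ}
    (hgens : autGensOK n Hsyn Hstab s.gens = true) (hst : s.structOK n Hsyn wmax = true)
    (hzeroA : s.A.zeroCaseOK n wmax (found.map Prod.fst) = true)
    (hzeroB : s.B.zeroCaseOK n wmax (found.map Prod.fst) = true)
    (htopA : ∀ z ∈ s.A.zList n, TopReaches (bzLeaf wmax (found.map Prod.fst)) (s.A.lightRowsW s.wA n) (s.A.topRow z) (s.t - 1))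
    (htopB : ∀ z ∈ s.B.zList n, TopReaches (bzLeaf wmax (found.map Prod.fst)) (s.B.lightRowsW s.wB n) (s.B.topRow z) (s.t - 1))
    (w : Fin n → ZMod 2) (hw : rowMatrix n Hsyn *ᵥ w = 0) (hw' : w ∉ rowSpace (rowMatrix n Hstab)) :
    wmax < hammingNorm w := by
  by_contra hle
  rw [not_lt] at hle
  simp only [ShiftSideW.structOK, Bool.and_eq_true, decide_eq_true_eq, List.all_eq_true, List.mem_range, beq_iff_eq] at hst
  obtain ⟨⟨⟨hA, hB⟩, hAB⟩, ht⟩ := hst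
  have hBA : countB s.B.inL (suppIdx n w) = countB (fun x => !(s.A.inL x)) (suppIdx n w) :=
    countB_congr _ _ _ fun x hx => hAB x (lt_of_mem_suppIdx n w hx)
  rcases blocks_pigeonhole w s.A.inL (le_trans hle ht) with hAle | hBle
  · exact half_soundW hcomm hfound hgens s.A s.wA hA hzeroA htopA w hw hw' hle hAle
  · exact half_soundW hcomm hfound hgens s.B s.wB hB hzeroB htopB w hw hw' hle (hBA ▸ hBle)

end Sound

/-! ## The certificate-level statements -/

namespace DistCert

variable (c : DistCert)

/-- **`Z`-side lower bound from the windowed shift lane** (the `lowZ` hypothesis of `isCode_of_onesided_lower`). (theorem) -/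
theorem lowZ_of_shiftW (hs : c.checkStructure = true) (s : ShiftSideW)
    (hgens : autGensOK c.n c.HX c.HZ s.gens = true) (hst : s.structOK c.n c.HX (c.dZ - 1) = true)
    (hzeroA : s.A.zeroCaseOK c.n (c.dZ - 1) (c.sideZ.found.map Prod.fst) = true)
    (hzeroB : s.B.zeroCaseOK c.n (c.dZ - 1) (c.sideZ.found.map Prod.fst) = true)
    (htopA : ∀ z ∈ s.A.zList c.n,
      TopReaches (bzLeaf (c.dZ - 1) (c.sideZ.found.map Prod.fst)) (s.A.lightRowsW s.wA c.n) (s.A.topRow z) (s.t - 1))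
    (htopB : ∀ z ∈ s.B.zList c.n,
      TopReaches (bzLeaf (c.dZ - 1) (c.sideZ.found.map Prod.fst)) (s.B.lightRowsW s.wB c.n) (s.B.topRow z) (s.t - 1)) :
    ∀ w : Fin c.n → ZMod 2, rowMatrix c.n c.HX *ᵥ w = 0 → w ∉ rowSpace (rowMatrix c.n c.HZ) →
      c.dZ - 1 < hammingNorm w := by
  have h' := hs
  simp only [checkStructure, Bool.and_eq_true] at h'
  exact shift_lower_soundW (comm_of_commOK (c.commOK_of_checkStructure hs)) h'.1.1.2 s hgens hst hzeroA hzeroB htopA htopB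

/-- **`d_Z` from the windowed shift lane** (upper: the certificate's weight-`dZ` witness; lower: `lowZ_of_shiftW`). (theorem) -/
theorem dZ_code_of_shiftW (hs : c.checkStructure = true) (s : ShiftSideW)
    (hgens : autGensOK c.n c.HX c.HZ s.gens = true) (hst : s.structOK c.n c.HX (c.dZ - 1) = true)
    (hzeroA : s.A.zeroCaseOK c.n (c.dZ - 1) (c.sideZ.found.map Prod.fst) = true)
    (hzeroB : s.B.zeroCaseOK c.n (c.dZ - 1) (c.sideZ.found.map Prod.fst) = true)
    (htopA : ∀ z ∈ s.A.zList c.n,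
      TopReaches (bzLeaf (c.dZ - 1) (c.sideZ.found.map Prod.fst)) (s.A.lightRowsW s.wA c.n) (s.A.topRow z) (s.t - 1))
    (htopB : ∀ z ∈ s.B.zList c.n,
      TopReaches (bzLeaf (c.dZ - 1) (c.sideZ.found.map Prod.fst)) (s.B.lightRowsW s.wB c.n) (s.B.topRow z) (s.t - 1))
    (hd : 1 ≤ c.dZ) : (c.code (c.commOK_of_checkStructure hs)).dZ = c.dZ := by
  have h' := hs
  simp only [checkStructure, Bool.and_eq_true] at h'
  obtain ⟨hv, hv', hwt⟩ := upper_sound h'.1.1.1.2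
  refine (c.code _).dZ_eq_of_witness hv hv' hwt fun w hw hw' => ?_
  have := c.lowZ_of_shiftW hs s hgens hst hzeroA hzeroB htopA htopB w hw hw'
  omega

end DistCert

end Summit.Ventures.QEC.Census
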